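import Literature.Topology.FourManifolds.TubularNbhdTrim
import Literature.Topology.FourManifolds.KirbyMovesShrinkProofs
import Literature.Topology.FourManifolds.LinkSurgeryPresentationMoves
import HarnessLib

/-!
# From a surgery presentation with disjoint unit tubes to `IsIntegralSurgeryLink`

Topic `Literature/Topology/FourManifolds`; plumbing between the presentation
`Link.IsSurgeryPresentation IY Y L ν` (`LinkSurgeryUniqueness.lean`: `Y` glued from `S³ ∖ L` and
solid tori along `Link.surgeryRel ν i`, which only sees the tubes `νᵢ` on the open unit disc
bundles `S¹ × D̊²`) and the relational integral surgery `IsIntegralSurgeryLink IY Y L m`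
(`DehnSurgery.lean`), which in addition asks for the framing integers `(νᵢ).HasFraming (m i)`
and for the FULL ranges `range νᵢ = νᵢ (S¹ × ℝ²)` to be pairwise disjoint.  A handle attachment
along a framed link (Kirby 1989, Ch. I §2: `DottedCircleDiagram.Realization`) only makes the open
unit tubes `νᵢ (S¹ × D̊²)` disjoint (they are the boundary values of attaching maps with disjoint
ranges); this file closes the gap:

**Lemma** (`Link.IsSurgeryPresentation.isIntegralSurgeryLink_of_disjoint_unitTubes`; Rolfsen
1976, §9.F: the surgery "uses a tubular neighbourhood of any radius"; Kosinski 1993, III (3.4)).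
If `Y` is presented as surgery on `L` with tubes `νᵢ` of framings `m i` whose open unit tubes are
pairwise disjoint, then `IsIntegralSurgeryLink IY Y L m`.  Proof: rescale the tubes to radius
`1/2` (`Link.IsSurgeryPresentation.scale_of_disjoint_unitTubes`, the variant of
`Link.IsSurgeryPresentation.scale` of `KirbyMovesShrinkProofs.lean` under the weaker
disjointness; framings are kept, `HasFraming.scale`), then trim each rescaled tube inside its own
open unit tube (`Knot.TubularNbhd.exists_trim`, `TubularNbhdTrim.lean`: unchanged on the closed
unit disc bundle, same framings), which does not change the presentation
(`Link.isSurgeryPresentation_congr`).  Everything here is proved; no named facts are introduced.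

## References

* D. Rolfsen, *Knots and Links* (1976), §9.F. [Rolfsen1976]
* A. A. Kosinski, *Differential Manifolds* (1993), III (3.4). [Kosinski1993]
* R. C. Kirby, *The Topology of 4-Manifolds*, LNM 1374 (1989), Ch. I §2, §5. [Kirby1989]
-/

open scoped Manifold ContDiff Topology
open Set Function Metric

noncomputable section

namespace Literature.Topology.FourManifolds

/-- Local notation: `𝔼 n` is the model Euclidean space `EuclideanSpace ℝ (Fin n)`. -/
local notation "𝔼 " n:arg => EuclideanSpace ℝ (Fin n)

/-- Local notation: `𝕊 n` is the unit sphere in `EuclideanSpace ℝ (Fin (n + 1))`. -/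
local notation "𝕊 " n:arg => (Metric.sphere (0 : EuclideanSpace ℝ (Fin (n + 1))) 1)

section Presentation

universe u v w u'

variable {EY : Type u} {HY : Type v} [NormedAddCommGroup EY] [NormedSpace ℝ EY]
  [TopologicalSpace HY] {IY : ModelWithCorners ℝ EY HY} {Y : Type w} [TopologicalSpace Y]
  [ChartedSpace HY Y] {ι : Type u'} [Finite ι]

/-- **Off the core, a point of an open unit tube lies in the link complement** when the open unit
tubes `νᵢ (S¹ × D̊²)` are pairwise disjoint (each contains its own component as the zero
section). [folklore] -/
theorem Link.apply_mem_complement_of_disjoint_unitTubes {L : Link ι}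
    (ν : ∀ i, Knot.TubularNbhd (L.component i))
    (hdisj : Pairwise fun i j ↦ Disjoint (ν i '' (univ ×ˢ Metric.ball (0 : 𝔼 2) 1))
      (ν j '' (univ ×ˢ Metric.ball (0 : 𝔼 2) 1)))
    (i : ι) (x : 𝕊 1) {w : 𝔼 2} (hw0 : w ≠ 0) (hw : ‖w‖ < 1) : ν i (x, w) ∈ L.complement := by
  rw [Link.mem_complement_iff]
  intro j hmem
  by_cases hji : j = i
  · subst hji
    exact (ν j).apply_mem_compl_range hw0 hmem
  · obtain ⟨y, hy⟩ := hmem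
    have h1 : ν i (x, w) ∈ ν i '' (univ ×ˢ Metric.ball (0 : 𝔼 2) 1) :=
      ⟨(x, w), ⟨mem_univ _, by rwa [mem_ball_zero_iff]⟩, rfl⟩
    have h2 : ν i (x, w) ∈ ν j '' (univ ×ˢ Metric.ball (0 : 𝔼 2) 1) :=
      ⟨(y, 0), ⟨mem_univ _, by rw [mem_ball_zero_iff, norm_zero]; exact one_pos⟩,
        by rw [Knot.TubularNbhd.coe_apply_zero, hy]⟩
    exact Set.disjoint_left.1 (hdisj hji) h2 h1

/-- **Rescaling a surgery presentation (disjoint open unit tubes suffice).**  The variant of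
`Link.IsSurgeryPresentation.scale` in which only the open unit tubes `νᵢ (S¹ × D̊²)` are assumed
pairwise disjoint: keep `jA`, replace `jBᵢ` by `jBᵢ ∘ (p, v) ↦ (rᵢ p, v)`; the annulus
`jBᵢ {rᵢ ≤ ‖p‖ < 1}` is covered by the link complement because `νᵢ (u, t v)` (`t < 1`) lies in
the `i`-th open unit tube, off every component. [cite: Rolfsen1976, §9.F] -/
theorem Link.IsSurgeryPresentation.scale_of_disjoint_unitTubes {L : Link ι}
    {ν : ∀ i, Knot.TubularNbhd (L.component i)}
    (hdisj : Pairwise fun i j ↦ Disjoint (ν i '' (univ ×ˢ Metric.ball (0 : 𝔼 2) 1))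
      (ν j '' (univ ×ˢ Metric.ball (0 : 𝔼 2) 1)))
    (h : L.IsSurgeryPresentation IY Y ν) (r : ι → ℝ) (hr : ∀ i, 0 < r i) (hr1 : ∀ i, r i ≤ 1) :
    L.IsSurgeryPresentation IY Y fun i ↦ (ν i).scale (r i) (hr i) := by
  -- adapted from `Link.IsSurgeryPresentation.scale` (KirbyMovesShrinkProofs.lean)
  obtain ⟨jA, jB, hA, hAo, hB, hcov, hBdisj, hglue⟩ := h
  set Φ : ι → OpenPartialHomeomorph solidTorus solidTorus :=
    fun i ↦ solidTorusScale (r i) (hr i) (hr1 i) with hΦ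
  refine ⟨jA, fun i ↦ jB i ∘ Φ i, hA, hAo, fun i ↦ ⟨?_, ?_⟩, ?_, ?_, fun i a b ↦ ?_⟩
  · exact (hB i).1.comp_openPartialHomeomorph (Φ i) rfl
      (contMDiff_solidTorusScale _ _ _).contMDiffOn (contMDiffOn_solidTorusScale_symm _ _ _)
  · rw [hΦ, range_comp_solidTorusScale]
    exact (Topology.IsOpenEmbedding.mk (hB i).1.isEmbedding (hB i).2).isOpenMap _
      (solidTorusScale (r i) (hr i) (hr1 i)).open_target
  · -- the pieces still cover `Y`
    refine eq_univ_of_forall fun y ↦ ?_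
    rcases eq_univ_iff_forall.1 hcov y with hy | hy
    · exact Or.inl hy
    · obtain ⟨i, hy⟩ := mem_iUnion.1 hy
      obtain ⟨b, rfl⟩ := hy
      by_cases hbr : ‖(b : (𝔼 2) × (𝕊 1)).1‖ < r i
      · refine Or.inr (mem_iUnion.2 ⟨i, (Φ i).symm b, ?_⟩)
        change jB i (Φ i ((Φ i).symm b)) = jB i b
        rw [(Φ i).right_inv (show b ∈ (Φ i).target from hbr)]
      · refine Or.inl ?_
        set p : 𝔼 2 := (b : (𝔼 2) × (𝕊 1)).1 with hp
        set v : 𝕊 1 := (b : (𝔼 2) × (𝕊 1)).2 with hv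
        have hp1 : ‖p‖ < 1 := (mem_solidTorus_iff _).1 b.2
        have hp0 : 0 < ‖p‖ := (hr i).trans_le (not_lt.1 hbr)
        set t : ℝ := ‖p‖ with ht
        have hu1 : t⁻¹ • p ∈ Metric.sphere (0 : 𝔼 2) 1 := by
          rw [mem_sphere_zero_iff_norm, norm_smul, norm_inv, Real.norm_of_nonneg hp0.le, ← ht,
            inv_mul_cancel₀ hp0.ne']
        set u : 𝕊 1 := ⟨t⁻¹ • p, hu1⟩ with hu
        have hpu : p = t • (u : 𝔼 2) := by
          change p = t • (t⁻¹ • p)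
          rw [smul_inv_smul₀ hp0.ne']
        have htv : ‖t • (v : 𝔼 2)‖ < 1 := by
          rw [norm_smul, norm_eq_of_mem_sphere v, mul_one, Real.norm_of_nonneg hp0.le]; exact hp1
        have ha₀ : ν i (u, t • (v : 𝔼 2)) ∈ L.complement :=
          Link.apply_mem_complement_of_disjoint_unitTubes ν hdisj i u
            (smul_ne_zero hp0.ne' (ne_zero_of_mem_unit_sphere v)) htv
        refine ⟨⟨ν i (u, t • (v : 𝔼 2)), ha₀⟩, ?_⟩
        rw [hglue i]
        exact ⟨u, t, ⟨hp0, hp1⟩, hpu, rfl⟩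
  · intro i j hij
    refine Disjoint.mono ?_ ?_ (hBdisj hij) <;> rw [range_comp] <;> exact image_subset_range _ _
  · change jA a = jB i (Φ i b) ↔ _
    rw [hglue i a (Φ i b)]
    change (ν i).glueRel (a : 𝕊 3) ((Φ i b : solidTorus) : (𝔼 2) × (𝕊 1)) ↔
      ((ν i).scale (r i) (hr i)).glueRel (a : 𝕊 3) (b : (𝔼 2) × (𝕊 1))
    rw [hΦ, coe_solidTorusScale_apply,
      (ν i).glueRel_scale_iff (hr i) (hr1 i) _ ((mem_solidTorus_iff _).1 b.2)]

/-- **A surgery presentation with framed tubes whose open unit tubes are pairwise disjoint is an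
integral surgery** (`IsIntegralSurgeryLink`): rescale to radius `1/2` and trim each tube inside
its own open unit tube (`Knot.TubularNbhd.exists_trim`), keeping the framings and the
presentation. [cite: Rolfsen1976, §9.F] -/
theorem Link.IsSurgeryPresentation.isIntegralSurgeryLink_of_disjoint_unitTubes {L : Link ι}
    {ν : ∀ i, Knot.TubularNbhd (L.component i)} {m : ι → ℤ}
    (h : L.IsSurgeryPresentation IY Y ν) (hfr : ∀ i, (ν i).HasFraming (m i))
    (hdisj : Pairwise fun i j ↦ Disjoint (ν i '' (univ ×ˢ Metric.ball (0 : 𝔼 2) 1))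
      (ν j '' (univ ×ˢ Metric.ball (0 : 𝔼 2) 1))) :
    IsIntegralSurgeryLink IY Y L m := by
  have h2 := h.scale_of_disjoint_unitTubes hdisj (fun _ ↦ 1 / 2) (fun _ ↦ one_half_pos)
    (fun _ ↦ by norm_num)
  -- trim each rescaled tube inside its own open unit tube
  have hV : ∀ i, IsOpen (ν i '' (univ ×ˢ Metric.ball (0 : 𝔼 2) 1)) := fun i ↦
    (ν i).isOpen_image (isOpen_univ.prod Metric.isOpen_ball)
  have hsub : ∀ i, (ν i).scale (1 / 2) one_half_pos '' (univ ×ˢ Metric.closedBall (0 : 𝔼 2) 1) ⊆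
      ν i '' (univ ×ˢ Metric.ball (0 : 𝔼 2) 1) := fun i ↦ by
    rw [Knot.TubularNbhd.image_scale_closedBall]
    refine image_mono (prod_mono le_rfl ?_)
    exact Metric.closedBall_subset_ball (by norm_num)
  choose ν₂ hν₂eq hν₂V _hν₂r hν₂fr using fun i ↦
    ((ν i).scale (1 / 2) one_half_pos).exists_trim (hV i) (hsub i)
  refine ⟨ν₂, fun i ↦ (hν₂fr i _).2 (Knot.TubularNbhd.HasFraming.scale (ν i) _ _ (hfr i)),
    fun i j hij ↦ (hdisj hij).mono (hν₂V i) (hν₂V j), ?_⟩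
  exact (Link.isSurgeryPresentation_congr fun i x w hw ↦ (hν₂eq i x w hw.le).symm).1 h2

end Presentation

end Literature.Topology.FourManifolds
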